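import Literature.MathematicalPhysics.QuantumFieldTheory.Balaban1983to89.B9Eq3105FamTwoCore
import Literature.MathematicalPhysics.QuantumFieldTheory.Balaban1983to89.B9Eq3105ZetaY

/-!
# `Balaban1983to89.B9Eq3105FamTwoCover` — FAMILY 2 OF (3.105) SUMMED OVER THE COVER CUBES OF A MEMBER: `Σ_□ (1 − ζ_□̃)·DPD*·h_□O_□h_□ ≺
# 3·5^{d+1}·(K_PB_OΛc₁·e^{−a_sep·δ₀·D_sep})·e^{−ρδ₀d}` over the member's bond carrier (finite overlap of the sources `S_□`), and the same with the letters' (3.42)₀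
# blocks read off their `EBlock`s (sub-row G-B9-LETTERS, GAPS G-B9-05 «family 2 of (3.105)», programme ZETA-2, FILE Z2-cover)

statement-level skeleton of published theorems with citation tags; proofs where landed; nothing here is a claim about the Yang–Mills mass gap

THE PRINTED LOCUS (verbatim, held `paper:balaban1985-cmp99-background-propagators`, journal page = PDF page + 388).  p. 414 (3.105) and l. −6…−1 («supp h_□ is
separated from supp (1 − ζ_□̃) by a distance ≧ M … we will prove that they are small also. More exactly, it will follow from this analysis that R satisfies the bound
(3.85) with O(M⁻¹) instead of O(α₁). For M sufficiently large this implies G = G₀(I − R)⁻¹»); (3.91) p. 410 («□′ ∩ □ ≠ ∅»: finitely many cubes meet a cube); p. 411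
l. 12–14; p. 412 l. 31–36; Cor. 3.6 p. 408; [4] (2.83)–(2.85) pp. 237–238, (2.36) p. 229, p. 235, Lemma 2.1 (2.61) p. 234.

WHY THIS FILE.  Z2-core `B9Eq3105FamTwoCore.hasMajorant_famTwo_core` bounds ONE summand with the source indicator `𝟙[b′ ∈ S_□]`; every index lies in `≤ 3·5^{d+1}`
of the `S_□` (p21∕p38 `hcnt_SQT`), so p21's `B9Thm39Sum.hasMajorant_localSum_right` sums the family (§1).  §2 reads the letters' input `hO □` off the `EBlock`s the
consumer already holds (`hE : ∀ □, EBlock (kernelFamilyBInv i B cfg (Oc □) par) B₀ δ U₁`, via `hasMajorant_conj_G_of_eBlockInvB`), leaving displayed exactly what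
the consumer `eBlock_kernelFamilyBInv_GAY_of_localInverseCubes''` itself displays on the member geometry ((2.61), here also the scale transfer of `ℓ²`) plus the ONE
member-level input of the programme: the (3.49)₄ block majorant `hP` of `conj b(P)` (for `P = DPDsY i parS Gp U₁`: r06's letter-free composition engine on the landed
member letters — ZETA-2's closing file).

WHAT THIS FILE CERTIFIES (kernel-checked; 0 `def`, 0 `def … : Prop`, 0 sorry; standard axioms only)

* §1 ★★★ `hasMajorant_sum_famTwo` — for any family of site cut-offs `ζ_□` (`|1 − ζ_□| ≤ 1`, `hζsep` with one `D_sep`), any `P` with `hP`, any letters `O_□` with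
  `hO □ : conj b(O_□) ≺ B_O·ℓ²·e^{−b_Oδ₀d}`, (2.61) at `b_O − ρ`, the scale transfer of `ℓ²`, `α_st + a_sep + ρ ≤ a_P`:
  `Σ_□ conj b(((1 − M_{ζ_□})·P·(M_{h_□}·O_□·M_{h_□})).rS) ≺ 3·5^{d+1}·(K_PB_OΛc₁(δ₀,b_O−ρ)·e^{−a_sep·δ₀·D_sep})·e^{−ρδ₀d(a,b′)}` over `(toB6 (geo9K i) Rr Hp, ιB∘blkV1)`.
* §2 ★★★ `hasMajorant_sum_famTwo_of_eBlock` — the same with `O_□ := Oc □ (cfg U₁)` and `hO` DISCHARGED from `hE` (`B_O = M₂(Σ‖b_j‖)B₀`, `b_Oδ₀ = δ`): the consumer's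
  family-2 summand of `hrest` VERBATIM, `≺ Θ₂·e^{−a_sep·δ·D_sep}·e^{−ρδ·d}` with `Θ₂ = 3·5^{d+1}K_P(M₂Σ‖b_j‖B₀)Λc₁(δ, 1−ρ)` — modulo `hP`, `hζsep`, (2.61), the transfer.
* §3 ★★★ `hasMajorant_sum_famTwo_zetaY_of_eBlock` — §2 at the ζ OF RECORD `zetaY i □` (p33 `B9Eq3105ZetaY`, p674649): `hζ1`, `hζsep` DISCHARGED, `D_sep = DsepT i =
  M_h∕(2L)`; displayed: `hE`, `hP`, (2.61), the transfer of `ℓ²` — i.e. exactly the consumer's own displayed geometry plus the ONE programme input `hP`.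

HONEST SCOPE ∕ NOT CLAIMED.  DISPLAYED: `hP` (member (3.49)₄ — NOT proved here), `hζsep` (for `ζ = zetaY`: `B9Eq3105ZetaY.DsepT_le_dist_bond`, review lane p674649),
(2.61) and the scale transfer on the member geometry above its threshold (`B9GeoInputsMultiRateKLevelV1`), `hE`, the numerical side conditions (§3 discharges `hζ1`∕`hζsep`); the smallness
bookkeeping against `hsmall` is the assembler's.  NOT here: families 3–4, the `hV′` twin (trailing `P`: α-T).  Count-neutral; NOT a node discharge; no summit ∕
sub-problem statement is proved; nothing continuum ∕ OS ∕ mass-gap ∕ Clay; YM mass gap NOT proved (Track A conditional rung).  No `sorry`, no `axiom`, no `… : Prop`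
fact, no `instance`, no `notation`, no `def`.  NEW file; nothing landed is modified.  Cell `lit-balaban`, seat `lit-balaban-p33` gen 102, 2026-08-28;
`--supports stmt-QuantumFields-19200` as helper.  Net new unproved facts: 0.

RELATED IN THE TREE, NOT DUPLICATED: Z2-core `B9Eq3105FamTwoCore`, p33 `B9Eq3105ZetaY`, p21 `B9Thm39Sum.hasMajorant_localSum_right`, p21∕p38 `B9Thm37GpTorusRegularCubes.hcnt_SQT`,
`B9CubeLettersInvReadDictBMajorants.hasMajorant_conj_G_of_eBlockInvB`, p38 `B9Thm310GTorusRegular` (family 1's analogous sum) — all USED BY NAME.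
-/

noncomputable section

namespace Literature.MathematicalPhysics.QuantumFieldTheory.Balaban1983to89.B9Eq3105FamTwoCover

open B6RandomWalk (HasMajorant hasMajorant_mono Ineq261 c1_nonneg)
open B9Thm34Ext (toB6)
open B9Thm39Sum (hasMajorant_localSum_right)
open B9Ineq347 (ScaleTransfer)
open B9Eq352DivFormLetters (conj)
open B9FromB6 (EBlock)
open B6KLevelCensusIndexV1 (KIdx)
open B6Cover236MultiLevelBlocks (cubes)
open B6GlobalChartV1 (blkV1)
open B6Ineq2142KLevelV1 (β)
open B9GeoNormsKLevelV1 (geo9K)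
open B9GeoLemma21KLevelV1 (geo9K_dist_nonneg')
open B9Thm37CubeCoverCommutators (cutMulY hTY)
open B9Thm37GpTorusRegularCubes (SQT hcnt_SQT)
open B9Eq3104CutoffCommutators (hBdY)
open B9CubeLettersInvReadings (kernelFamilyBInv)
open B9CubeLettersInvReadDictBMajorants (hasMajorant_conj_G_of_eBlockInvB)
open B9Eq3105FamTwoCore (hasMajorant_famTwo_core)
open B9Eq3105ZetaY (zetaY abs_one_sub_zetaY_le_one DsepT_le_dist_bond)
open B9Thm39CinvAtCover (DsepT)
open Node00 (SiteY BlkY IBondY FBondY CfgY BondOpY BondParY toKT)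

variable {d ℓ : ℕ} {hd : 1 ≤ d + 1} {hL : Odd (ℓ + 1) ∧ 1 < ℓ + 1} {b₀ b₁ : ℝ}
variable {𝔸 : Type} [NormedRing 𝔸] [NormedAlgebra ℂ 𝔸] [CompleteSpace 𝔸]
variable {ι : Type} [Fintype ι]
variable (i : KIdx d ℓ hd hL b₀ b₁) (b : Module.Basis ι ℝ 𝔸)

/-! ## §1  The cover sum for displayed letter majorants -/

omit [CompleteSpace 𝔸] in
open Classical in
set_option maxHeartbeats 1600000 in
/-- ★★★ **FAMILY 2 OF (3.105) SUMMED OVER THE COVER**: `Σ_□ conj b(((1 − M_{ζ_□})·P·(M_{h_□}·O_□·M_{h_□})).rS) ≺ 3·5^{d+1}·(K_PB_OΛc₁·e^{−a_sep·δ₀·D_sep})·e^{−ρδ₀d}`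
(Z2-core per cube with the source indicator `𝟙[b′ ∈ S_□]`, `Σ_□ 𝟙[b′ ∈ S_□] ≤ 3·5^{d+1}`, `hasMajorant_localSum_right`).
[cite: Balaban1985BackgroundPropagators, (3.105) p.414, (3.91) p.410, p.411 l.12–14, p.412 l.31–36; Balaban1984PropagatorsII, (2.83)–(2.85) pp.237–238, (2.36) p.229, p.235, Lemma 2.1 (2.61) p.234] -/
theorem hasMajorant_sum_famTwo (ζ : ↥(cubes i.D.toDomains) → SiteY i → ℝ) (hζ1 : ∀ c z, |1 - ζ c z| ≤ 1)
    [Fintype (geo9K i).Site] (ιB : BlkY i → IBondY i) (hι : ∀ s, β i.hN i.D i.hk (ιB s) = s) (Rr : ℝ) (Hp : Prop) {Dsep : ℝ}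
    (hζsep : ∀ (c : ↥(cubes i.D.toDomains)) (f g : FBondY i), hBdY i (ζ c) f ≠ 1 → hBdY i (hTY i c) g ≠ 0 →
      Dsep ≤ (geo9K i).dist (ιB (blkV1 i.hN i.D f)) (ιB (blkV1 i.hN i.D g)))
    (P : (FBondY i → 𝔸) →ₗ[ℂ] (FBondY i → 𝔸)) (O : ↥(cubes i.D.toDomains) → (FBondY i → 𝔸) →ₗ[ℂ] (FBondY i → 𝔸)) (dB : ℕ)
    {δ₀ aP bO αst asep ρ KP BO Λ : ℝ}
    (hδ₀ : 0 ≤ δ₀) (hKP : 0 ≤ KP) (hBO : 0 ≤ BO) (hΛ : 0 ≤ Λ) (hasep : 0 ≤ asep) (hρ : 0 ≤ ρ) (hsplit : αst + asep + ρ ≤ aP)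
    (h261 : Ineq261 dB (toB6 (geo9K i) Rr Hp) δ₀ (bO - ρ)) (hST : ScaleTransfer (geo9K i) δ₀ αst Λ (fun a => (geo9K i).len a ^ 2))
    (hP : HasMajorant (g := toB6 (geo9K i) Rr Hp) (fun p : FBondY i × ι => ιB (blkV1 i.hN i.D p.1)) (conj b (P.restrictScalars ℝ))
      (fun a y => KP * ((geo9K i).len a ^ 2)⁻¹ * Real.exp (-(aP * δ₀ * (geo9K i).dist a y))))
    (hO : ∀ c : ↥(cubes i.D.toDomains), HasMajorant (g := toB6 (geo9K i) Rr Hp) (fun p : FBondY i × ι => ιB (blkV1 i.hN i.D p.1))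
      (conj b ((O c).restrictScalars ℝ)) (fun y b' => BO * (geo9K i).len y ^ 2 * Real.exp (-(bO * δ₀ * (geo9K i).dist y b')))) :
    HasMajorant (g := toB6 (geo9K i) Rr Hp) (fun p : FBondY i × ι => ιB (blkV1 i.hN i.D p.1))
      (∑ c : ↥(cubes i.D.toDomains), conj b (((1 - cutMulY (𝔸 := 𝔸) (hBdY i (ζ c))) * P *
        (cutMulY (𝔸 := 𝔸) (hBdY i (hTY i c)) * O c * cutMulY (𝔸 := 𝔸) (hBdY i (hTY i c)))).restrictScalars ℝ))
      (fun a b' => (3 * 5 ^ (d + 1)) *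
        ((KP * BO * Λ * B6.c1 dB δ₀ (bO - ρ) * Real.exp (-(asep * δ₀ * Dsep))) * Real.exp (-(ρ * δ₀ * (geo9K i).dist a b')))) := by
  have hκ : 0 ≤ KP * BO * Λ * B6.c1 dB δ₀ (bO - ρ) * Real.exp (-(asep * δ₀ * Dsep)) :=
    mul_nonneg (mul_nonneg (mul_nonneg (mul_nonneg hKP hBO) hΛ) (c1_nonneg _ _ _)) (Real.exp_nonneg _)
  exact hasMajorant_localSum_right (G := toB6 (geo9K i) Rr Hp) (fun p : FBondY i × ι => ιB (blkV1 i.hN i.D p.1))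
    (fun c => conj b (((1 - cutMulY (𝔸 := 𝔸) (hBdY i (ζ c))) * P *
      (cutMulY (𝔸 := 𝔸) (hBdY i (hTY i c)) * O c * cutMulY (𝔸 := 𝔸) (hBdY i (hTY i c)))).restrictScalars ℝ))
    (fun c b' => if b' ∈ SQT i c then (1 : ℝ) else 0)
    (fun a b' => (KP * BO * Λ * B6.c1 dB δ₀ (bO - ρ) * Real.exp (-(asep * δ₀ * Dsep))) * Real.exp (-(ρ * δ₀ * (geo9K i).dist a b')))
    (3 * 5 ^ (d + 1)) (fun a b' => mul_nonneg hκ (Real.exp_nonneg _))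
    (fun c => hasMajorant_famTwo_core i c b (ζ c) (hζ1 c) ιB hι Rr Hp (hζsep c) P (O c) dB hδ₀ hKP hBO hΛ hasep hρ hsplit h261 hST hP (hO c))
    (hcnt_SQT i)

/-! ## §2  The letters' blocks read off their `EBlock`s (the consumer's `hE`) -/

variable {B : B9.Backgrounds} (cfg : B.Cfg → CfgY 𝔸 i) {U₁ : B.Cfg}

open Classical in
set_option maxHeartbeats 1600000 in
/-- ★★★ **THE CONSUMER's FAMILY-2 SUMMAND OF `hrest`, MODULO THE MEMBER P-WORD MAJORANT**: with `hE : ∀ □, EBlock (kernelFamilyBInv i B cfg (Oc □) par) B₀ δ U₁`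
(the (3.42) blocks of the cut letters — F-F″ for `O_□ = locLetterBY …`), a family of cut-offs `ζ_□` with `|1 − ζ_□| ≤ 1` and the `D_sep`-separation from `supp h_□`,
the member (3.49)₄ majorant `hP` of `conj b(P)` at rate `a_P·δ`, (2.61) at `(δ, 1 − ρ)`, the scale transfer of `ℓ²` at `(δ, α_st)`, `α_st + a_sep + ρ ≤ a_P`:
`Σ_□ conj b(((1 − M_{ζ_□})·P·(M_{h_□}·Oc □ (cfg U₁)·M_{h_□})).rS) ≺ 3·5^{d+1}·(K_P(M₂Σ‖b_j‖B₀)Λc₁(δ,1−ρ)·e^{−a_sep·δ·D_sep})·e^{−ρδ·d(a,b′)}`.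
[cite: Balaban1985BackgroundPropagators, (3.105) p.414, Cor. 3.6 p.408, (3.87) p.409, p.411 l.12–14, p.412 l.31–36, (3.91) p.410; Balaban1984PropagatorsII, (2.83)–(2.85) pp.237–238, (2.51)–(2.55) p.232, Lemma 2.1 (2.61) p.234] -/
theorem hasMajorant_sum_famTwo_of_eBlock (par : BondParY 𝔸 i) (Oc : ↥(cubes i.D.toDomains) → BondOpY 𝔸 i) {B₀ δ : ℝ} (hB₀ : 0 ≤ B₀) (hδ : 0 ≤ δ)
    (hE : ∀ c : ↥(cubes i.D.toDomains), EBlock (kernelFamilyBInv i B cfg (Oc c) par) B₀ δ U₁)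
    {M₂ : ℝ} (hM₂ : 0 ≤ M₂) (hrepr : ∀ (v : 𝔸) (j : ι), |b.repr v j| ≤ M₂ * ‖v‖)
    (ζ : ↥(cubes i.D.toDomains) → SiteY i → ℝ) (hζ1 : ∀ c z, |1 - ζ c z| ≤ 1)
    [Fintype (geo9K i).Site] (ιB : BlkY i → IBondY i) (hι : ∀ s, β i.hN i.D i.hk (ιB s) = s) (Rr : ℝ) (Hp : Prop) {Dsep : ℝ}
    (hζsep : ∀ (c : ↥(cubes i.D.toDomains)) (f g : FBondY i), hBdY i (ζ c) f ≠ 1 → hBdY i (hTY i c) g ≠ 0 →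
      Dsep ≤ (geo9K i).dist (ιB (blkV1 i.hN i.D f)) (ιB (blkV1 i.hN i.D g)))
    (P : (FBondY i → 𝔸) →ₗ[ℂ] (FBondY i → 𝔸)) (dB : ℕ) {aP αst asep ρ KP Λ : ℝ}
    (hKP : 0 ≤ KP) (hΛ : 0 ≤ Λ) (hasep : 0 ≤ asep) (hρ : 0 ≤ ρ) (hsplit : αst + asep + ρ ≤ aP)
    (h261 : Ineq261 dB (toB6 (geo9K i) Rr Hp) δ (1 - ρ)) (hST : ScaleTransfer (geo9K i) δ αst Λ (fun a => (geo9K i).len a ^ 2))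
    (hP : HasMajorant (g := toB6 (geo9K i) Rr Hp) (fun p : FBondY i × ι => ιB (blkV1 i.hN i.D p.1)) (conj b (P.restrictScalars ℝ))
      (fun a y => KP * ((geo9K i).len a ^ 2)⁻¹ * Real.exp (-(aP * δ * (geo9K i).dist a y)))) :
    HasMajorant (g := toB6 (geo9K i) Rr Hp) (fun p : FBondY i × ι => ιB (blkV1 i.hN i.D p.1))
      (∑ c : ↥(cubes i.D.toDomains), conj b (((1 - cutMulY (𝔸 := 𝔸) (hBdY i (ζ c))) * P *
        (cutMulY (𝔸 := 𝔸) (hBdY i (hTY i c)) * Oc c (cfg U₁) * cutMulY (𝔸 := 𝔸) (hBdY i (hTY i c)))).restrictScalars ℝ))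
      (fun a b' => (3 * 5 ^ (d + 1)) *
        ((KP * (M₂ * (∑ j, ‖b j‖) * B₀) * Λ * B6.c1 dB δ (1 - ρ) * Real.exp (-(asep * δ * Dsep))) * Real.exp (-(ρ * δ * (geo9K i).dist a b')))) := by
  have hSb : 0 ≤ ∑ j, ‖b j‖ := Finset.sum_nonneg fun _ _ => norm_nonneg _
  have hBO : 0 ≤ M₂ * (∑ j, ‖b j‖) * B₀ := mul_nonneg (mul_nonneg hM₂ hSb) hB₀
  have hO : ∀ c : ↥(cubes i.D.toDomains), HasMajorant (g := toB6 (geo9K i) Rr Hp) (fun p : FBondY i × ι => ιB (blkV1 i.hN i.D p.1))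
      (conj b ((Oc c (cfg U₁)).restrictScalars ℝ))
      (fun y b' => (M₂ * (∑ j, ‖b j‖) * B₀) * (geo9K i).len y ^ 2 * Real.exp (-(1 * δ * (geo9K i).dist y b'))) := fun c =>
    hasMajorant_mono (g := toB6 (geo9K i) Rr Hp) _
      (hasMajorant_conj_G_of_eBlockInvB i b cfg (Oc c) par (Rr := Rr) (Hp := Hp) (hE c) hB₀ ιB hι hM₂ hrepr ((Oc c (cfg U₁)).restrictScalars ℝ) (fun _ => rfl))
      fun a a' => by rw [one_mul]
  exact hasMajorant_sum_famTwo i b ζ hζ1 ιB hι Rr Hp hζsep P (fun c => Oc c (cfg U₁)) dB (bO := 1) hδ hKP hBO hΛ hasep hρ hsplit h261 hST hP hO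


/-! ## §3  At the cut-off of record `ζ_□̃ = zetaY i □` (`|1 − ζ| ≤ 1` and the separation `D_sep = M∕(2L²)` are theorems of `B9Eq3105ZetaY`) -/

open Classical in
set_option maxHeartbeats 1600000 in
/-- ★★★ **THE CONSUMER's FAMILY-2 SUMMAND AT THE ζ OF RECORD**: `hasMajorant_sum_famTwo_of_eBlock` with `ζ_□ := zetaY i □` — `hζ1`, `hζsep` DISCHARGED
(`abs_one_sub_zetaY_le_one`, `DsepT_le_dist_bond`, `D_sep = DsepT i = M_h∕(2L)`); displayed: `hE`, the member P-word majorant `hP`, (2.61), the transfer of `ℓ²`.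
[cite: Balaban1985BackgroundPropagators, (3.105) p.414 («supp h_□ is separated from supp (1 − ζ_□̃) by a distance ≧ M»), Cor. 3.6 p.408, p.411 l.12–14, p.412 l.31–36, (3.91) p.410; Balaban1984PropagatorsII, (2.83)–(2.85) pp.237–238, Lemma 2.1 (2.61) p.234] -/
theorem hasMajorant_sum_famTwo_zetaY_of_eBlock (par : BondParY 𝔸 i) (Oc : ↥(cubes i.D.toDomains) → BondOpY 𝔸 i) {B₀ δ : ℝ} (hB₀ : 0 ≤ B₀) (hδ : 0 ≤ δ)
    (hE : ∀ c : ↥(cubes i.D.toDomains), EBlock (kernelFamilyBInv i B cfg (Oc c) par) B₀ δ U₁)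
    {M₂ : ℝ} (hM₂ : 0 ≤ M₂) (hrepr : ∀ (v : 𝔸) (j : ι), |b.repr v j| ≤ M₂ * ‖v‖)
    [Fintype (geo9K i).Site] (ιB : BlkY i → IBondY i) (hι : ∀ s, β i.hN i.D i.hk (ιB s) = s) (Rr : ℝ) (Hp : Prop)
    (P : (FBondY i → 𝔸) →ₗ[ℂ] (FBondY i → 𝔸)) (dB : ℕ) {aP αst asep ρ KP Λ : ℝ}
    (hKP : 0 ≤ KP) (hΛ : 0 ≤ Λ) (hasep : 0 ≤ asep) (hρ : 0 ≤ ρ) (hsplit : αst + asep + ρ ≤ aP)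
    (h261 : Ineq261 dB (toB6 (geo9K i) Rr Hp) δ (1 - ρ)) (hST : ScaleTransfer (geo9K i) δ αst Λ (fun a => (geo9K i).len a ^ 2))
    (hP : HasMajorant (g := toB6 (geo9K i) Rr Hp) (fun p : FBondY i × ι => ιB (blkV1 i.hN i.D p.1)) (conj b (P.restrictScalars ℝ))
      (fun a y => KP * ((geo9K i).len a ^ 2)⁻¹ * Real.exp (-(aP * δ * (geo9K i).dist a y)))) :
    HasMajorant (g := toB6 (geo9K i) Rr Hp) (fun p : FBondY i × ι => ιB (blkV1 i.hN i.D p.1))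
      (∑ c : ↥(cubes i.D.toDomains), conj b (((1 - cutMulY (𝔸 := 𝔸) (hBdY i (zetaY i c))) * P *
        (cutMulY (𝔸 := 𝔸) (hBdY i (hTY i c)) * Oc c (cfg U₁) * cutMulY (𝔸 := 𝔸) (hBdY i (hTY i c)))).restrictScalars ℝ))
      (fun a b' => (3 * 5 ^ (d + 1)) *
        ((KP * (M₂ * (∑ j, ‖b j‖) * B₀) * Λ * B6.c1 dB δ (1 - ρ) * Real.exp (-(asep * δ * DsepT i))) * Real.exp (-(ρ * δ * (geo9K i).dist a b')))) :=
  hasMajorant_sum_famTwo_of_eBlock i b cfg par Oc hB₀ hδ hE hM₂ hrepr (fun c => zetaY i c) (fun c z => abs_one_sub_zetaY_le_one i c z) ιB hι Rr Hp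
    (fun c _ _ hf hg => DsepT_le_dist_bond i c ιB hι hf hg) P dB hKP hΛ hasep hρ hsplit h261 hST hP

end Literature.MathematicalPhysics.QuantumFieldTheory.Balaban1983to89.B9Eq3105FamTwoCover

end
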